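import Literature.Geometry.GaugeTheory.AdaptedFramesQuasiKaehler
import Literature.Geometry.GaugeTheory.AdaptedFramesCanonicalConnection
import Literature.Geometry.Symplectic.CompatibleMetricUnitaryFrameField
import Literature.Geometry.Kaehler.OneFormDerivativeVectorFields
import Literature.Geometry.Lorentzian.LeviCivitaProofs
import Literature.Geometry.Lorentzian.TangentialConnection
import HarnessLib

/-!
# The trace of the Hessian as an exact form on an almost-Kähler `4`-manifold:
# `d(df ∘ J)(e₀, e₁) + d(df ∘ J)(e₂, e₃) = -Σ_k Hess f(e_k, e_k)` in a unitary frame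

Topic `Literature/Geometry/GaugeTheory`; continues `AdaptedFramesQuasiKaehler` (unitary adapted
frames `J e_k = ε_k e_{κk}`, frame Christoffel symbols `Γ_{a;b,c} = g(∇_{e_a}e_b, e_c)`, the
quasi-Kähler identity `A(a,b,c) + ε_aε_b A(κa,κb,c) = 0` of the components `A` of `∇J` when
`ds = 0`, `[e_a, e_b] = ∇_{e_a}e_b - ∇_{e_b}e_a`) with the degree-one invariant formula for `d`
(`Kaehler/OneFormDerivativeVectorFields`) and the Hessian `Hess f(X,Y) = X(Yf) - (∇_XY)f` of
`Lorentzian/LeviCivita` (`hessianAux`).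

On an almost-Hermitian manifold the Hodge star of a 1-form is `⋆α = (α ∘ J) ∧ ω^{n-1}/(n-1)!`, so
when `dω = 0` the Laplace–Beltrami operator on functions is `Δf·vol = ∓ d((df ∘ J) ∧ ω) =
∓ d(df ∘ J) ∧ ω`: the trace of the Hessian is the `ω`-component of the exact 2-form `d(df ∘ J)`.
This file proves the pointwise frame identity behind this (the cancellation of the `∇J`-terms being
exactly the quasi-Kähler identity `(∇_{e₁}J)e₀ = (∇_{e₀}J)e₁`, `(∇_{e₃}J)e₂ = (∇_{e₂}J)e₃`):

* `jGradForm J f = df ∘ J` as a real 1-form, smooth for smooth `f` (`smoothAt_jGradForm`);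
* `sum_frameChristoffel_diag_eq`: `Σ_k Γ_{k;k,c} = ε_c (Γ_{0;1,κc} - Γ_{1;0,κc} + Γ_{2;3,κc} - Γ_{3;2,κc})`,
  i.e. `J([e₀,e₁] + [e₂,e₃]) = -Σ_k ∇_{e_k}e_k` (quasi-Kähler);
* **`mextDeriv_jGradForm_frame_sum`**: `d(df∘J)(e₀,e₁) + d(df∘J)(e₂,e₃) = -Σ_k Hess f(e_k,e_k)`.

Integrated against `ω ∧ ω` on a closed symplectic `4`-manifold this gives `∫ Δf ω² = 0`
(`Symplectic/SymplecticTraceHessianIntegral`), the integration by parts behind the `L²` bound on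
`∇_Aψ` in Taubes 1994, §2 (proof of Lemma 3).

PROVED, 0 named facts.

## References

* M. Falcitelli, S. Ianus, A. M. Pastore, *Riemannian Submersions and Related Topics* (2004),
  Ch. 3 §3.1 (Kähler form, `δ`, almost-Hermitian identities). [FalcitelliPastoreIanus2004]
* F. W. Warner, *Foundations of Differentiable Manifolds and Lie Groups*, GTM 94 (1983),
  Prop. 2.25(f), 6.1–6.2 (`⋆`, `δ`, `Δ`). [WarnerGTM94]
* C. H. Taubes, *The Seiberg–Witten invariants and symplectic forms*, Math. Res. Lett. 1 (1994)
  809–822, §2 (proof of Lemma 3). [Taubes1994]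
-/

noncomputable section

open scoped Manifold ContDiff Topology Bundle
open Set Function Filter Bundle VectorField
open Literature.Geometry.Lorentzian (PseudoRiemannianMetric contMDiffAt_clm_apply_iff)
open Literature.Topology.FourManifolds (SmoothOrientation)
open Literature.Geometry.Kaehler (MForm IsSmoothForm mextDeriv)
open Literature.Geometry.Symplectic (AlmostComplexStructure)

namespace Literature.Geometry.GaugeTheory

/-! ### Algebra: the trace identity from the quasi-Kähler identity -/

section Algebra

/-- **`Σ_k Γ_{k;k,c} = ε_c (Γ_{0;1,κc} - Γ_{1;0,κc} + Γ_{2;3,κc} - Γ_{3;2,κc})`** for the frame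
Christoffel symbols of a unitary frame of a quasi-Kähler (e.g. almost-Kähler) manifold — the frame
form of `J([e₀, e₁] + [e₂, e₃]) = -Σ_k ∇_{e_k} e_k`: the quasi-Kähler identity with `(a, b) = (0, 1)`
reads `A(0,1,c) - A(1,0,c) = 0`, i.e. `ε_c(Γ_{0;1,κc} - Γ_{1;0,κc}) = Γ_{0;0,c} + Γ_{1;1,c}`, and
similarly for `(2, 3)`. [cite: FalcitelliPastoreIanus2004, Ch. 3 §3.1, Tables 3.1–3.2] -/
theorem sum_frameChristoffel_diag_eq (Γ : Fin 4 → Fin 4 → Fin 4 → ℝ)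
    (hiii : ∀ a b c, covJCoeffOf AdaptedFrames.jIdx AdaptedFrames.jSgn Γ a b c +
      covJCoeffOf AdaptedFrames.jIdx AdaptedFrames.jSgn Γ b c a + covJCoeffOf AdaptedFrames.jIdx AdaptedFrames.jSgn Γ c a b = 0)
    (c : Fin 4) :
    ∑ k : Fin 4, Γ k k c = AdaptedFrames.jSgn c *
      (Γ 0 1 (AdaptedFrames.jIdx c) - Γ 1 0 (AdaptedFrames.jIdx c) + Γ 2 3 (AdaptedFrames.jIdx c) - Γ 3 2 (AdaptedFrames.jIdx c)) := by
  have q01 := covJCoeffOf_add_map_map AdaptedFrames.jIdx_jIdx AdaptedFrames.jSgn_jIdx AdaptedFrames.jSgn_mul_self Γ hiii 0 1 c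
  have q23 := covJCoeffOf_add_map_map AdaptedFrames.jIdx_jIdx AdaptedFrames.jSgn_jIdx AdaptedFrames.jSgn_mul_self Γ hiii 2 3 c
  simp only [covJCoeffOf, AdaptedFrames.jIdx, AdaptedFrames.jSgn, Matrix.cons_val_zero, Matrix.cons_val_one, Matrix.cons_val,
    Fin.sum_univ_four] at q01 q23 ⊢
  norm_num at q01 q23 ⊢
  linear_combination -q01 - q23

end Algebra

/-! ### The 1-form `df ∘ J` -/

section JGrad

variable {X : Type*} [TopologicalSpace X] [ChartedSpace (EuclideanSpace ℝ (Fin 4)) X] [IsManifold (𝓡 4) ∞ X]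
  (J : AlmostComplexStructure (𝓡 4) ∞ X)

/-- **The real 1-form `df ∘ J`**: `v ↦ df(Jv)` (minus the usual `d^c f = -df ∘ J`; with `g(Ju, v) = ω(u, v)`
it is `⋆df` up to `∧ ω`: `⋆α = (α ∘ J) ∧ ω` for 1-forms in real dimension `4`). [cite: WarnerGTM94, 6.1] -/
def jGradForm (f : X → ℝ) : RealOneForm X := fun x ↦ (mvfderiv (𝓡 4) f x).comp (J x)

/-- `(df ∘ J)(v) = df(Jv)`. [folklore] -/
@[simp] theorem jGradForm_apply (f : X → ℝ) (x : X) (v : TangentSpace (𝓡 4) x) :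
    jGradForm J f x v = mvfderiv (𝓡 4) f x (J x v) := rfl

/-- **The covector field `w ↦ df(J e.symmL w)` is smooth at `x₀`** for smooth `f` (the derivative of
`f` along the smooth field `x ↦ J_x(e.symmL x w)`). [folklore] -/
theorem contMDiffAt_jGradForm_comp_symmL {f : X → ℝ} (hf : ContMDiff (𝓡 4) 𝓘(ℝ, ℝ) ∞ f) (x₀ : X) :
    ContMDiffAt (𝓡 4) 𝓘(ℝ, (EuclideanSpace ℝ (Fin 4)) →L[ℝ] ℝ) ∞ (fun x ↦ (jGradForm J f x).comp
      ((trivializationAt (EuclideanSpace ℝ (Fin 4)) (TangentSpace (𝓡 4) : X → Type _) x₀).symmL ℝ x)) x₀ := by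
  rw [contMDiffAt_clm_apply_iff]
  intro w
  have hW := Literature.Geometry.Symplectic.AlmostComplexStructure.IsCompatibleWith.contMDiffAt_map_field J
    (contMDiffAt_symmL_trivializationAt x₀ w)
  have hf' : ContMDiffAt (𝓡 4) 𝓘(ℝ, ℝ) (∞ + 1) f x₀ := by simpa using hf x₀
  exact Literature.Geometry.Lorentzian.contMDiffAt_mvfderiv_apply_of_le hf' hW

/-- **`df ∘ J` is smooth** for smooth `f`: its chart representative at `x₀` is the smooth covector field
of `contMDiffAt_jGradForm_comp_symmL` read through `ofSubsingleton`, the inverse extended chart having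
derivative `e.symmL`. [folklore] -/
theorem smoothAt_jGradForm {f : X → ℝ} (hf : ContMDiff (𝓡 4) 𝓘(ℝ, ℝ) ∞ f) (x₀ : X) :
    (jGradForm J f).SmoothAt x₀ := by
  obtain ⟨F, hF⟩ : ∃ F : X → (EuclideanSpace ℝ (Fin 4)) →L[ℝ] ℝ, F = fun x ↦ (jGradForm J f x).comp
      ((trivializationAt (EuclideanSpace ℝ (Fin 4)) (TangentSpace (𝓡 4) : X → Type _) x₀).symmL ℝ x) := ⟨_, rfl⟩
  have hFs : ContMDiffAt (𝓡 4) 𝓘(ℝ, (EuclideanSpace ℝ (Fin 4)) →L[ℝ] ℝ) ∞ F x₀ := hF ▸ contMDiffAt_jGradForm_comp_symmL J hf x₀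
  have hG : ContMDiffAt (𝓡 4) 𝓘(ℝ, (EuclideanSpace ℝ (Fin 4)) [⋀^Fin 1]→L[ℝ] ℝ) ∞
      ((fun L : (EuclideanSpace ℝ (Fin 4)) →L[ℝ] ℝ ↦ ContinuousAlternatingMap.ofSubsingleton ℝ (EuclideanSpace ℝ (Fin 4)) ℝ (0 : Fin 1) L) ∘ F) x₀ :=
    (ContinuousAlternatingMap.ofSubsingletonLIE (𝕜 := ℝ) (E := (EuclideanSpace ℝ (Fin 4))) (F := ℝ) (0 : Fin 1)).toContinuousLinearEquiv.contDiff.comp_contMDiffAt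
      hFs
  have hG' : ContDiffWithinAt ℝ ∞
      (((fun L : (EuclideanSpace ℝ (Fin 4)) →L[ℝ] ℝ ↦ ContinuousAlternatingMap.ofSubsingleton ℝ (EuclideanSpace ℝ (Fin 4)) ℝ (0 : Fin 1) L) ∘ F) ∘
        (extChartAt (𝓡 4) x₀).symm) (range (𝓡 4)) (extChartAt (𝓡 4) x₀ x₀) := by
    simpa using (contMDiffAt_iff.1 hG).2
  have hev : ∀ y ∈ (extChartAt (𝓡 4) x₀).target, (jGradForm J f).toMForm.inChart x₀ y =
      ContinuousAlternatingMap.ofSubsingleton ℝ (EuclideanSpace ℝ (Fin 4)) ℝ (0 : Fin 1) (F ((extChartAt (𝓡 4) x₀).symm y)) := by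
    intro y hy
    have hx : (extChartAt (𝓡 4) x₀).symm y ∈ (chartAt (EuclideanSpace ℝ (Fin 4)) x₀).source := by
      rw [← extChartAt_source (𝓡 4)]
      exact (extChartAt (𝓡 4) x₀).map_target hy
    have hD : mfderivWithin 𝓘(ℝ, (EuclideanSpace ℝ (Fin 4))) (𝓡 4) (extChartAt (𝓡 4) x₀).symm (range (𝓡 4)) y =
        (trivializationAt (EuclideanSpace ℝ (Fin 4)) (TangentSpace (𝓡 4) : X → Type _) x₀).symmL ℝ ((extChartAt (𝓡 4) x₀).symm y) := by
      rw [TangentBundle.symmL_trivializationAt hx, (extChartAt (𝓡 4) x₀).right_inv hy]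
    ext v
    rw [Literature.Geometry.Kaehler.MForm.inChart_apply, hD, ContinuousAlternatingMap.ofSubsingleton_apply_apply]
    simp only [hF, RealOneForm.toMForm_apply, ContinuousLinearMap.comp_apply]
    rfl
  unfold RealOneForm.SmoothAt
  refine hG'.congr_of_eventuallyEq ?_ (hev _ (mem_extChartAt_target x₀))
  filter_upwards [extChartAt_target_mem_nhdsWithin x₀] with y hy using hev y hy

/-- `df ∘ J` is a smooth form for smooth `f`. [folklore] -/
theorem isSmoothForm_toMForm_jGradForm {f : X → ℝ} (hf : ContMDiff (𝓡 4) 𝓘(ℝ, ℝ) ∞ f) :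
    IsSmoothForm (jGradForm J f).toMForm := fun x ↦ smoothAt_jGradForm J hf x

omit [IsManifold (𝓡 4) ∞ X] in
/-- Derivative of a constant multiple: `d(c·u)(v) = c·du(v)` for `u` differentiable at `x`. [folklore] -/
theorem mvfderiv_const_mul_apply {u : X → ℝ} {x : X} (hu : MDifferentiableAt (𝓡 4) 𝓘(ℝ, ℝ) u x) (c : ℝ)
    (v : TangentSpace (𝓡 4) x) :
    mvfderiv (𝓡 4) (fun y ↦ c * u y) x v = c * mvfderiv (𝓡 4) u x v := by
  rw [mvfderiv_fun_mul mdifferentiableAt_const hu, mvfderiv_const]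
  simp

end JGrad

/-! ### The trace identity in an adapted frame -/

namespace AdaptedFrames

variable {X : Type*} [TopologicalSpace X] [ChartedSpace (EuclideanSpace ℝ (Fin 4)) X] [IsManifold (𝓡 4) ∞ X]
  {g : PseudoRiemannianMetric (𝓡 4) ∞ (EuclideanSpace ℝ (Fin 4)) (TangentSpace (𝓡 4) : X → Type _)}
  {o : SmoothOrientation (𝓡 4) X} {J : AlmostComplexStructure (𝓡 4) ∞ X} {ι : Type*}
  (𝔞 : AdaptedFrames g o (fun x ↦ ((J x : TangentSpace (𝓡 4) x →L[ℝ] TangentSpace (𝓡 4) x) :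
    TangentSpace (𝓡 4) x →ₗ[ℝ] TangentSpace (𝓡 4) x)) ι) [g.HasLeviCivita]

omit [g.HasLeviCivita] in
/-- The directional derivative `e_b f` along a frame field is differentiable at the points of the
chart, for smooth `f`. [folklore] -/
theorem mdifferentiableAt_mvfderiv_frame {f : X → ℝ} (hf : ContMDiff (𝓡 4) 𝓘(ℝ, ℝ) ∞ f) (i : ι) (b : Fin 4)
    {x : X} (hx : x ∈ 𝔞.baseSet i) :
    MDifferentiableAt (𝓡 4) 𝓘(ℝ, ℝ) (fun y ↦ mvfderiv (𝓡 4) f y (𝔞.frame i b y)) x := by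
  have hf' : ContMDiffAt (𝓡 4) 𝓘(ℝ, ℝ) (∞ + 1) f x := by simpa using hf x
  exact (Literature.Geometry.Lorentzian.contMDiffAt_mvfderiv_apply_of_le hf'
    (𝔞.toSpincStructure.contMDiffAt_frame i b hx)).mdifferentiableAt (by simp)

omit [g.HasLeviCivita] in
/-- **`(df ∘ J)(e_b) = ε_b · (e_{κb} f)` near a point of the chart** (`J e_b = ε_b e_{κb}`). [folklore] -/
theorem jGradForm_frame_eventuallyEq (f : X → ℝ) (i : ι) (b : Fin 4) {x : X} (hx : x ∈ 𝔞.baseSet i) :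
    (fun y ↦ (jGradForm J f).toMForm y ![𝔞.frame i b y]) =ᶠ[𝓝 x]
      fun y ↦ jSgn b * mvfderiv (𝓡 4) f y (𝔞.frame i (jIdx b) y) := by
  filter_upwards [(𝔞.isOpen_baseSet i).mem_nhds hx] with y hy
  have h := 𝔞.map_frame i hy b
  rw [ContinuousLinearMap.coe_coe] at h
  rw [RealOneForm.toMForm_apply, Matrix.cons_val_zero, jGradForm_apply, h, map_smul, smul_eq_mul]

/-- **The trace of the Hessian in a unitary frame is the `ω`-component of the exact form `d(df ∘ J)`**:
on an adapted chart of `(X, g, J)` with `s(u, v) = g(Ju, v)` smooth and closed (almost-Kähler), for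
a smooth function `f` and `x ∈ U_i`,
`d(df∘J)(e₀, e₁) + d(df∘J)(e₂, e₃) = -Σ_k (e_k(e_k f) - (∇_{e_k}e_k) f) = -Σ_k Hess f(e_k, e_k)`.
Warner's formula `dθ(Y₀,Y₁) = Y₀(θY₁) - Y₁(θY₀) - θ[Y₀,Y₁]` on the frame fields, `θ(e_b) = ε_b e_{κb}f`,
`[e_a,e_b] = ∇_{e_a}e_b - ∇_{e_b}e_a`, and `J([e₀,e₁] + [e₂,e₃]) = -Σ_k ∇_{e_k}e_k` (quasi-Kähler).
[cite: FalcitelliPastoreIanus2004, Ch. 3 §3.1] -/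
theorem mextDeriv_jGradForm_frame_sum (i : ι) {x : X} (hx : x ∈ 𝔞.baseSet i)
    (s : MForm (𝓡 4) X ℝ 2) (hsm : IsSmoothForm s) (hcl : Literature.Geometry.Kaehler.IsClosedForm s)
    (hsJ : ∀ y ∈ 𝔞.baseSet i, ∀ v w : TangentSpace (𝓡 4) y, s y ![v, w] = g.val y (J y v) w)
    {f : X → ℝ} (hf : ContMDiff (𝓡 4) 𝓘(ℝ, ℝ) ∞ f) :
    mextDeriv (jGradForm J f).toMForm x ![𝔞.frame i 0 x, 𝔞.frame i 1 x] +
        mextDeriv (jGradForm J f).toMForm x ![𝔞.frame i 2 x, 𝔞.frame i 3 x] =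
      -∑ k, g.hessianAux f (𝔞.frame i k) (𝔞.frame i k) x := by
  have hα : DifferentiableWithinAt ℝ ((jGradForm J f).toMForm.inChart x) (range (𝓡 4)) (extChartAt (𝓡 4) x x) :=
    (smoothAt_jGradForm J hf x).differentiableWithinAt
  have hsJ' : ∀ y ∈ 𝔞.baseSet i, ∀ v w : TangentSpace (𝓡 4) y, s y ![v, w] =
      g.val y ((((J y : TangentSpace (𝓡 4) y →L[ℝ] TangentSpace (𝓡 4) y) :
        TangentSpace (𝓡 4) y →ₗ[ℝ] TangentSpace (𝓡 4) y)) v) w := fun y hy v w ↦ by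
    rw [ContinuousLinearMap.coe_coe]
    exact hsJ y hy v w
  -- Warner's formula on the frame fields
  have hd : ∀ a b : Fin 4, mextDeriv (jGradForm J f).toMForm x ![𝔞.frame i a x, 𝔞.frame i b x] =
      jSgn b * mvfderiv (𝓡 4) (fun y ↦ mvfderiv (𝓡 4) f y (𝔞.frame i (jIdx b) y)) x (𝔞.frame i a x)
        - jSgn a * mvfderiv (𝓡 4) (fun y ↦ mvfderiv (𝓡 4) f y (𝔞.frame i (jIdx a) y)) x (𝔞.frame i b x)
        - mvfderiv (𝓡 4) f x (J x (g.leviCivita (𝔞.frame i b) x (𝔞.frame i a x) - g.leviCivita (𝔞.frame i a) x (𝔞.frame i b x))) := by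
    intro a b
    rw [Literature.Geometry.Kaehler.mextDeriv_apply_vectorField (I := 𝓡 4) (F := ℝ) hα
        (Y₀ := 𝔞.frame i a) (Y₁ := 𝔞.frame i b) (𝔞.mdifferentiableAt_frame i a hx) (𝔞.mdifferentiableAt_frame i b hx),
      Literature.Geometry.Lorentzian.mvfderiv_congr_nhds (𝔞.jGradForm_frame_eventuallyEq f i b hx),
      Literature.Geometry.Lorentzian.mvfderiv_congr_nhds (𝔞.jGradForm_frame_eventuallyEq f i a hx),
      mvfderiv_const_mul_apply (𝔞.mdifferentiableAt_mvfderiv_frame hf i (jIdx b) hx),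
      mvfderiv_const_mul_apply (𝔞.mdifferentiableAt_mvfderiv_frame hf i (jIdx a) hx),
      RealOneForm.toMForm_apply, Matrix.cons_val_zero, jGradForm_apply, 𝔞.mlieBracket_frame_eq i hx]
  -- the quasi-Kähler cancellation: `J(∇₀e₁ - ∇₁e₀ + ∇₂e₃ - ∇₃e₂) = -Σ_k ∇_{e_k} e_k`
  have hiii := 𝔞.covJCoeffOf_frameChristoffel_cyclic i hx s hsm hcl hsJ'
  have hV : J x (g.leviCivita (𝔞.frame i 1) x (𝔞.frame i 0 x) - g.leviCivita (𝔞.frame i 0) x (𝔞.frame i 1 x)) +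
      J x (g.leviCivita (𝔞.frame i 3) x (𝔞.frame i 2 x) - g.leviCivita (𝔞.frame i 2) x (𝔞.frame i 3 x)) =
      -∑ k, g.leviCivita (𝔞.frame i k) x (𝔞.frame i k x) := by
    refine 𝔞.eq_of_val_frame_eq i hx fun c ↦ ?_
    have hC := sum_frameChristoffel_diag_eq (𝔞.frameChristoffel i x) hiii c
    simp only [frameChristoffel_apply] at hC
    have hvm := fun u ↦ 𝔞.val_map_frame i hx u c
    simp only [ContinuousLinearMap.coe_coe] at hvm
    rw [map_add, add_apply, hvm, hvm, map_sub, sub_apply, map_sub, sub_apply, map_neg, neg_apply, map_sum, sum_apply, hC]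
    ring
  -- assemble
  have hdf := congr_arg (mvfderiv (𝓡 4) f x) hV
  rw [map_add, map_neg, map_sum] at hdf
  rw [hd 0 1, hd 2 3]
  simp only [PseudoRiemannianMetric.hessianAux, jIdx, jSgn, Matrix.cons_val_zero, Matrix.cons_val_one, Matrix.cons_val,
    Fin.sum_univ_four, map_sub] at hdf ⊢
  norm_num at hdf ⊢
  linarith [hdf]

end AdaptedFrames

end Literature.Geometry.GaugeTheory

end
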